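import Summits.BirchSwinnertonDyer.BirchSwinnertonDyer.Theorems.AlignedTransportAtTwoMainConjectureOfRankZeroBSDAtTwoCubicCarrierRoad
import Summits.BirchSwinnertonDyer.BirchSwinnertonDyer.Theorems.AlignedTransportAtTwoOffStratumRow2045b
import Summits.BirchSwinnertonDyer.BirchSwinnertonDyer.Theorems.AlignedTransportAtTwoOffStratumPartitionTwistFamilySmallSeeds
import Literature.NumberTheory.IwasawaTheory.Fukuda1994Thm1RankProofs
import Literature.NumberTheory.IwasawaTheory.CyclotomicTwoTotallyRamifiedIndexOne
import HarnessLib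

/-!
# Route `AlignedTransportAtTwo`, crux C2 `MainConjectureOfRankZeroBSDAtTwo` (stmt-22298), line `birth` — THE LAYER-`≥ 1` RANK DOOR, EVERY STRATUM:
# on `Δ_W < 0`, ONE equality of 2-RANKS of class groups at consecutive layers `n, n+1 ≥ 1` of the cyclotomic `ℤ₂`-tower of the cubic field `ℚ(β)`
# gives `MC₂(W)` (mod PRINT⁵ + MuIneqʳ) — NO condition on `Δ_min mod 8`, NO ramification bit; and the ROW at the off-stratum seed `2045b1`

HONEST FRAMING (cell `bsd-f1-sign2`, WIDTH-5 attach seat `bsd-line-att-p4` g24; `--supports stmt-BirchSwinnertonDyer-22298 --as helper`).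
THEOREMS ONLY (no `def`, no named fact, no `sorry`). BSD is NOT proved; C2 is NOT closed; its verdict «blocked-on
`Rank1Residual.GreenbergMuConjectureIrreducible`» is untouched; every statement is CONDITIONAL on the displayed PRINT named facts, the registered stub
MuIneqʳ (verbatim) and the displayed per-curve certificate.

WHY. The cubic road (att-p5 g24–g27, att-p3 g25) feeds C2's `Δ_W < 0` input H3M⁻ (`μ₂ = 0` along the cyclotomic `ℤ₂`-extensions of the complex cubic
`ℚ(β)`) through Fukuda's Thm. 1 (2) with index `n₀ = 0`, which needs every ramified prime TOTALLY ramified from layer `0` — proved on the Kilford stratum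
`Δ_min ≡ 1 (8)` (three primes, g25/g26), replaced by a Chevalley door on `Δ_min ≡ 5 (8)` (g26/g27), and MISSING on `Δ_min ≡ 3 (mod 4)` («needs a door with a
ramified prime above 2», g27) — where this lineage's certified off-stratum seed `2045b1` (`Δ_min = −5¹⁷·409 ≡ 3 (mod 8)`) lives. But the tree already
knows (cell bsd-2adic GEN 10, `Literature.NumberTheory.IwasawaTheory.forall_totallyRamifiedFrom_one_of_finrank_eq_three`: `e(w|2) ≤ [K:ℚ] = 3 < 4` for
every `w ∣ 2`) that Fukuda's index is `≤ 1` for EVERY cubic field and every cyclotomic `ℤ₂`-extension. Hence: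

* §1 **`mazurMainConjecture_two_of_muIneqRel_of_classGroupPRank_succ_eq_of_one_le`** — PRINT⁵ {Kato 17.4 (1)(2) at `2`, Greenberg 4.1, period unit,
  modularity, GZK} + MuIneqʳ + cell hypotheses (good ordinary at `2`, no rational `2`-torsion abscissa, `Δ_W < 0`, `r_an = 0`, analytic `μ₂ = 0` on the even
  branch, `BSD₂(W)`) + `β` a root of the `2`-division cubic + PER CURVE, for every cyclotomic `ℤ₂`-extension `κP` of `ℚ(β)`: ONE layer pair `(n, n+1)` with
  `1 ≤ n` and equal `2`-RANKS of the class groups ⟹ `MC₂(W)` — NO hypothesis on `Δ_min mod 8`, NO displayed ramification bit (Fukuda Thm. 1 (2) =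
  tree theorem `fukuda1994_thm1_classGroupPRank_const_of_succ_eq_holds` at `n₀ = 1`; then att-p5 g24's
  `…CubicCarrierRoad.mazurMainConjecture_two_of_muIneqRel_of_classicalMu_cubicField_of_Δ_neg`). The cell's certificates ARE at layers `(1, 2)` (bsd-2adic kit
  j300990 for `1727a1`; att-p5 g25/g26), so this door reproduces the Kilford RANK door's rows (their extra reach, the layer pair `(0,1)`, is unused) and closes the `Δ_min ≡ 3 (mod 4)` gap in the door table.
* §2 **`mazurMainConjecture_two_2045b1_of_rankCert`** — THE ROW at `2045b1`: kernel facts (good ordinary at `2`, no rational `2`-torsion abscissa, `Δ < 0`;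
  g21 `…OffStratumRow2045b`), `BSD₂(2045b1)` := Creutz–Miller (PRINT, `N = 2045 < 5000`), displayed {`r_an(2045b1) = 0`, analytic `μ₂ = 0` on the even
  branch, one 2-rank equality at a layer pair `n, n+1 ≥ 1` per cyclotomic `κP` of `ℚ(β)`} — the same certificate SHAPE as the Kilford seeds' rows
  (g26 `mazurMainConjecture_two_1727a1_of_cubicRankLayer`). DATA ASK (-data / -imc): 2-ranks of `Cl(ℚ(β)(√2))` and `Cl(ℚ(β)(√(2+√2)))` for the cubic
  field of `2045b1` (`[1,−1,0,−5470,−862675]`, `u`-cubic `u³ − 3u² − 87520u − 55211200`).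
* §3 `mazurMainConjecture_two_1727a1_of_rankCert_layerOne` — the Kilford seed `1727a1` through the same door with g26's layer-(1,2) certificate and NO
  three-primes datum.

Beyond-print theorem: no (Fukuda + bookkeeping). BSD is NOT proved.

References: [Fukuda1994] Thm. 1 (2), p. 264; [Washington1997] §13.1 Lemma 13.3, §13.3; [Kato2004Asterisque] Thm. 17.4 (1)(2); [GreenbergLNM1716] Thm. 4.1,
Conj. 1.11; [CreutzMiller2012] Thm. 1.1; [CremonaAlgorithms1997] Table 1 (`2045b1`); [NeukirchANT1999] Ch. I §8 Prop. (8.2).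
-/

set_option linter.dupNamespace false
set_option autoImplicit false

noncomputable section

open scoped MatrixGroups ModularForm NumberField Classical
open CongruenceSubgroup WeierstrassCurve Polynomial NumberField Module Field
open Literature.NumberTheory.EllipticCurves Literature.NumberTheory.EllipticCurves.ModularForms
open Literature.NumberTheory.EllipticCurves.Greenberg1999 Literature.NumberTheory.EllipticCurves.Module
open Literature.NumberTheory.EllipticCurves.Rank1Residual Literature.NumberTheory.EllipticCurves.Rank1Residual.Typed
open Literature.NumberTheory.GaloisRepresentations Literature.NumberTheory.IwasawaTheory
open Summit.BirchSwinnertonDyer.Rank1Residual Summit.BirchSwinnertonDyer.Rank1Residual.F1Sign2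
open Summit.BirchSwinnertonDyer.Rank1Residual.X1.MuLambda Summit.BirchSwinnertonDyer.Rank1Residual.X5
open Summit.BirchSwinnertonDyer.BirchSwinnertonDyer.Theorems.Rank1ResidualX1Defs
open Summit.BirchSwinnertonDyer.BirchSwinnertonDyer.Theses.AlignedTransportAtTwo
open Summit.BirchSwinnertonDyer.BirchSwinnertonDyer.Theorems.AlignedTransportAtTwoCubicCarrierRoad
  (mazurMainConjecture_two_of_muIneqRel_of_classicalMu_cubicField_of_Δ_neg)
open Summit.BirchSwinnertonDyer.BirchSwinnertonDyer.Theorems.TowerClass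
open Summit.BirchSwinnertonDyer.BirchSwinnertonDyer.Theorems.AlignedTransportAtTwoOffStratumRow2045b
open Summit.BirchSwinnertonDyer.BirchSwinnertonDyer.Theorems.AlignedTransportAtTwoTwistFamilySmallSeeds

namespace Summit.BirchSwinnertonDyer.BirchSwinnertonDyer.Theorems.AlignedTransportAtTwoCubicRankDoorLayerOne

/-! ## §1 The layer-`≥ 1` RANK door, every stratum -/

/-- **THE LAYER-`≥ 1` RANK DOOR (Fukuda index `1` is automatic for cubic fields).** PRINT⁵ + MuIneqʳ (the registered stub verbatim) + the cell hypotheses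
(`Δ_W < 0`) + `β` a root of the `2`-division cubic + per curve, for every cyclotomic `ℤ₂`-extension `κP` of `ℚ(β)`: ONE layer pair `(n, n+1)`, `1 ≤ n`, with
`rank₂ Cl(ℚ(β)_{n+1}) = rank₂ Cl(ℚ(β)_n)` ⟹ `MC₂(W)`. No condition on `Δ_min mod 8`; no ramification bit: `TotallyRamifiedFrom κP 1` holds for every cubic
field (`forall_totallyRamifiedFrom_one_of_finrank_eq_three`), Fukuda Thm. 1 (2) from index `1` gives `μ₂(ℚ(β)) = 0`, and att-p5 g24's cubic-carrier road
concludes. CONDITIONAL; nothing closed; BSD is NOT proved. [cite: Fukuda1994, Thm. 1 (2), p. 264] [cite: Washington1997, §13.1 Lemma 13.3 (proof)]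
[cite: Kato2004Asterisque, Thm. 17.4 (1)(2) (p. 273)] [cite: GreenbergLNM1716, Thm. 4.1 (p. 102) and Conj. 1.11 (p. 58)] -/
theorem mazurMainConjecture_two_of_muIneqRel_of_classGroupPRank_succ_eq_of_one_le
    (W : WeierstrassCurve ℚ) [W.IsElliptic] [W.IsGloballyMinimal]
    (h17 : ∀ [NeZero (W.conductorNorm ℤ)] (f : CuspForm (Gamma0 (W.conductorNorm ℤ)) 2),
      kato_divisibility_allPrimes W 2 (f := f))
    (hGr : Greenberg1999.thm41_charValue_rankZero_anyPrime)
    (hper : realPeriodRat_eq_unit_mul_plusPeriod_two) (hmod : nonempty_modularParametrizationData)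
    (hGZK : rank_eq_analyticRank_of_analyticRank_le_one)
    (hI : ∀ (W : WeierstrassCurve ℚ) [W.IsElliptic] [W.IsGloballyMinimal], IsOrdinaryAt W 2 →
      (∀ x : ℚ, ¬ HasRationalTwoTorsionX W x) →
      ∀ (κ : ZpExtension ℚ 2) (γ : Field.absoluteGaloisGroup ℚ), κ.IsCyclotomic →
      κ.IsTopGenerator γ → IsCyclotomicVariable 2 γ →
      ∀ ⦃N : ℕ⦄ [NeZero N] (f : CuspForm (Gamma0 N) 2), IsNewformOf W f →
      ∀ Gp : IwasawaAlgebra 2, iwasawaToPowerSeries 2 Gp = padicLFunction f (unitRoot W 2 : ℚ_[2]) →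
      ∀ (D : W.SelmerDualData κ γ) (Yr : W.FineSelmerDualDataRelaxedInf κ γ),
        lengthAt (IwasawaAlgebra 2) D.X ⟨IwasawaAlgebra.augIdealP 2, IwasawaAlgebra.isPrime_augIdealP_holds 2⟩ ≤
          lengthAt (IwasawaAlgebra 2) (IwasawaAlgebra 2 ⧸ Ideal.span {Gp})
              ⟨IwasawaAlgebra.augIdealP 2, IwasawaAlgebra.isPrime_augIdealP_holds 2⟩ +
            lengthAt (IwasawaAlgebra 2) Yr.X ⟨IwasawaAlgebra.augIdealP 2, IwasawaAlgebra.isPrime_augIdealP_holds 2⟩)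
    (hord : IsOrdinaryAt W 2) (ht : ∀ x : ℚ, ¬ HasRationalTwoTorsionX W x) (hΔ : W.Δ < 0) (hr : W.analyticRank = 0)
    (hμan : ∀ ⦃N : ℕ⦄ [NeZero N] (f : CuspForm (Gamma0 N) 2), IsNewformOf W f →
      ∀ G : IwasawaAlgebra 2, IsEvenBranchLiftAtTwo W f G → red G ≠ 0)
    (hbsd : BSDp W 2)
    {β : AlgebraicClosure ℚ} (hβ : aeval β W.twoTorsionPolynomial.toPoly = 0)
    (hcert : ∀ κP : ZpExtension ↥(IntermediateField.adjoin ℚ ({β} : Set (AlgebraicClosure ℚ))) 2, κP.IsCyclotomic →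
      ∃ n : ℕ, 1 ≤ n ∧ classGroupPRank κP (n + 1) = classGroupPRank κP n) :
    MazurMainConjecture W 2 := by
  have hirr := AlignedTransportAtTwoSeed.irr_two_of_forall_not_hasRationalTwoTorsionX W ht
  haveI : FiniteDimensional ℚ ↥(IntermediateField.adjoin ℚ ({β} : Set (AlgebraicClosure ℚ))) :=
    IntermediateField.adjoin.finiteDimensional ((AlgebraicClosure.isAlgebraic ℚ).isAlgebraic β).isIntegral
  haveI : NumberField ↥(IntermediateField.adjoin ℚ ({β} : Set (AlgebraicClosure ℚ))) := NumberField.mk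
  have h3 : Module.finrank ℚ ↥(IntermediateField.adjoin ℚ ({β} : Set (AlgebraicClosure ℚ))) = 3 :=
    AddKatoTwo.finrank_adjoin_root_twoTorsionPolynomial_eq_three W hirr hβ
  refine mazurMainConjecture_two_of_muIneqRel_of_classicalMu_cubicField_of_Δ_neg W h17 hGr hper hmod hGZK hI hord ht hΔ hr
    hμan hbsd hβ fun κP hκP => ?_
  obtain ⟨n, hn1, hn⟩ := hcert κP hκP
  exact classicalMuVanishes_of_classGroupPRank_succ_eq fukuda1994_thm1_classGroupPRank_const_of_succ_eq_holds κP
    (forall_totallyRamifiedFrom_one_of_finrank_eq_three h3 κP hκP) hn1 hn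

/-! ## §2 The row at the certified off-stratum seed `2045b1` (`Δ_min ≡ 3 (mod 8)`) -/

/-- **THE ROW AT `2045b1`, cubic class-group currency, ONE 2-RANK certificate displayed.** Granted PRINT⁵ {Kato 17.4 (1)(2) at `2` for
`2045b1` (`h17`), Greenberg 4.1, period unit, modularity, GZK}, Creutz–Miller (`hCM`, `N = 2045 < 5000`) with GZK for `BSD₂(2045b1)`, the registered stub
MuIneqʳ verbatim (`hI`), the seed's analytic data (`r_an = 0`, analytic `μ₂ = 0` on the even branch), a root `β` of the `2`-division cubic of `2045b1`, and,
for every cyclotomic `ℤ₂`-extension `κP` of the complex cubic `ℚ(β)` (in which `2 = 𝔭₁𝔭₂²`): ONE layer pair `(n, n+1)`, `1 ≤ n`, with equal `2`-ranks of the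
class groups — Mazur's `2`-adic main conjecture for `2045b1`. Good ordinary at `2`, no rational `2`-torsion abscissa, `Δ < 0` and
are KERNEL (g21; `Δ_min ≡ 3 (mod 8)`: `minimalDiscriminantInt_emod_eight_2045b1`). CONDITIONAL; BSD is NOT proved. [cite: Fukuda1994, Thm. 1 (2), p. 264] [cite: CreutzMiller2012, Thm. 1.1]
[cite: Kato2004Asterisque, Thm. 17.4 (1)(2) (p. 273)] [cite: GreenbergLNM1716, Thm. 4.1 (p. 102) and Conj. 1.11 (p. 58)] -/
theorem mazurMainConjecture_two_2045b1_of_rankCert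
    (h17 : ∀ [NeZero (c2045b1.conductorNorm ℤ)] (f : CuspForm (Gamma0 (c2045b1.conductorNorm ℤ)) 2),
      kato_divisibility_allPrimes c2045b1 2 (f := f))
    (hGr : Greenberg1999.thm41_charValue_rankZero_anyPrime)
    (hper : realPeriodRat_eq_unit_mul_plusPeriod_two) (hmod : nonempty_modularParametrizationData)
    (hGZK : rank_eq_analyticRank_of_analyticRank_le_one) (hCM : bsdTriple_of_rank_le_one_of_conductor_lt)
    (hI : ∀ (W : WeierstrassCurve ℚ) [W.IsElliptic] [W.IsGloballyMinimal], IsOrdinaryAt W 2 →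
      (∀ x : ℚ, ¬ HasRationalTwoTorsionX W x) →
      ∀ (κ : ZpExtension ℚ 2) (γ : Field.absoluteGaloisGroup ℚ), κ.IsCyclotomic →
      κ.IsTopGenerator γ → IsCyclotomicVariable 2 γ →
      ∀ ⦃N : ℕ⦄ [NeZero N] (f : CuspForm (Gamma0 N) 2), IsNewformOf W f →
      ∀ Gp : IwasawaAlgebra 2, iwasawaToPowerSeries 2 Gp = padicLFunction f (unitRoot W 2 : ℚ_[2]) →
      ∀ (D : W.SelmerDualData κ γ) (Yr : W.FineSelmerDualDataRelaxedInf κ γ),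
        lengthAt (IwasawaAlgebra 2) D.X ⟨IwasawaAlgebra.augIdealP 2, IwasawaAlgebra.isPrime_augIdealP_holds 2⟩ ≤
          lengthAt (IwasawaAlgebra 2) (IwasawaAlgebra 2 ⧸ Ideal.span {Gp})
              ⟨IwasawaAlgebra.augIdealP 2, IwasawaAlgebra.isPrime_augIdealP_holds 2⟩ +
            lengthAt (IwasawaAlgebra 2) Yr.X ⟨IwasawaAlgebra.augIdealP 2, IwasawaAlgebra.isPrime_augIdealP_holds 2⟩)
    (hr0 : c2045b1.analyticRank = 0)
    (hμan : ∀ ⦃N : ℕ⦄ [NeZero N] (f : CuspForm (Gamma0 N) 2), IsNewformOf c2045b1 f →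
      ∀ G : IwasawaAlgebra 2, IsEvenBranchLiftAtTwo c2045b1 f G → red G ≠ 0)
    {β : AlgebraicClosure ℚ} (hβ : aeval β c2045b1.twoTorsionPolynomial.toPoly = 0)
    (hcert : ∀ κP : ZpExtension ↥(IntermediateField.adjoin ℚ ({β} : Set (AlgebraicClosure ℚ))) 2, κP.IsCyclotomic →
      ∃ n : ℕ, 1 ≤ n ∧ classGroupPRank κP (n + 1) = classGroupPRank κP n) :
    MazurMainConjecture c2045b1 2 :=
  mazurMainConjecture_two_of_muIneqRel_of_classGroupPRank_succ_eq_of_one_le c2045b1 h17 hGr hper hmod hGZK hI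
    goodOrd_two_2045b1 not_hasRationalTwoTorsionX_2045b1 Δ_2045b1_neg hr0 hμan (bsdp_two_2045b1_of_creutzMiller hCM hGZK hr0) hβ hcert

/-- Reading aid: `2045b1` is on the `Δ_min ≡ 3 (mod 4)` sub-cell (`2 = 𝔭₁𝔭₂²` in `ℚ(β)`, att-p5 g27): neither the Kilford RANK door (index `0` via three primes)
nor the `Δ_min ≡ 5 (8)` Chevalley door applies there — §1 does. [cite: CremonaAlgorithms1997, Table 1] -/
theorem minimalDiscriminantInt_emod_four_2045b1 : c2045b1.minimalDiscriminantInt % 4 = 3 := by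
  have h := minimalDiscriminantInt_emod_eight_2045b1
  omega

/-! ## §3 The Kilford seed `1727a1` through the same door (no three-primes dictionary) -/

/-- **THE ROW AT `1727a1` WITHOUT `h3p`**: att-p5 g26's `…CubicKilfordPrimesRow1727a1.mazurMainConjecture_two_1727a1_of_cubicRankLayer` displays the SAME
certificate (`rank₂` equal at layers `(1, 2)` of every cyclotomic `ℤ₂`-extension of `ℚ(β)`; numerically `2 = 2`, bsd-2adic kit j300990) but routes it through
index `0` (three primes above `2`); here index `1` is automatic, so the row needs no stratum datum. `BSD₂(1727a1)` := Creutz–Miller; displayed {`r_an = 0`,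
analytic `μ₂ = 0` on the even branch, the layer-`(1,2)` 2-rank equality}. CONDITIONAL; BSD is NOT proved. [cite: Fukuda1994, Thm. 1 (2), p. 264]
[cite: CreutzMiller2012, Thm. 1.1] [cite: Kato2004Asterisque, Thm. 17.4 (1)(2) (p. 273)] -/
theorem mazurMainConjecture_two_1727a1_of_rankCert_layerOne
    (h17 : ∀ [NeZero (c1727a1.conductorNorm ℤ)] (f : CuspForm (Gamma0 (c1727a1.conductorNorm ℤ)) 2),
      kato_divisibility_allPrimes c1727a1 2 (f := f))
    (hGr : Greenberg1999.thm41_charValue_rankZero_anyPrime)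
    (hper : realPeriodRat_eq_unit_mul_plusPeriod_two) (hmod : nonempty_modularParametrizationData)
    (hGZK : rank_eq_analyticRank_of_analyticRank_le_one) (hCM : bsdTriple_of_rank_le_one_of_conductor_lt)
    (hI : ∀ (W : WeierstrassCurve ℚ) [W.IsElliptic] [W.IsGloballyMinimal], IsOrdinaryAt W 2 →
      (∀ x : ℚ, ¬ HasRationalTwoTorsionX W x) →
      ∀ (κ : ZpExtension ℚ 2) (γ : Field.absoluteGaloisGroup ℚ), κ.IsCyclotomic →
      κ.IsTopGenerator γ → IsCyclotomicVariable 2 γ →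
      ∀ ⦃N : ℕ⦄ [NeZero N] (f : CuspForm (Gamma0 N) 2), IsNewformOf W f →
      ∀ Gp : IwasawaAlgebra 2, iwasawaToPowerSeries 2 Gp = padicLFunction f (unitRoot W 2 : ℚ_[2]) →
      ∀ (D : W.SelmerDualData κ γ) (Yr : W.FineSelmerDualDataRelaxedInf κ γ),
        lengthAt (IwasawaAlgebra 2) D.X ⟨IwasawaAlgebra.augIdealP 2, IwasawaAlgebra.isPrime_augIdealP_holds 2⟩ ≤
          lengthAt (IwasawaAlgebra 2) (IwasawaAlgebra 2 ⧸ Ideal.span {Gp})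
              ⟨IwasawaAlgebra.augIdealP 2, IwasawaAlgebra.isPrime_augIdealP_holds 2⟩ +
            lengthAt (IwasawaAlgebra 2) Yr.X ⟨IwasawaAlgebra.augIdealP 2, IwasawaAlgebra.isPrime_augIdealP_holds 2⟩)
    (hr0 : c1727a1.analyticRank = 0)
    (hμan : ∀ ⦃N : ℕ⦄ [NeZero N] (f : CuspForm (Gamma0 N) 2), IsNewformOf c1727a1 f →
      ∀ G : IwasawaAlgebra 2, IsEvenBranchLiftAtTwo c1727a1 f G → red G ≠ 0)
    {β : AlgebraicClosure ℚ} (hβ : aeval β c1727a1.twoTorsionPolynomial.toPoly = 0)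
    (hrank : ∀ κP : ZpExtension ↥(IntermediateField.adjoin ℚ ({β} : Set (AlgebraicClosure ℚ))) 2, κP.IsCyclotomic →
      classGroupPRank κP 2 = classGroupPRank κP 1) :
    MazurMainConjecture c1727a1 2 :=
  mazurMainConjecture_two_of_muIneqRel_of_classGroupPRank_succ_eq_of_one_le c1727a1 h17 hGr hper hmod hGZK hI
    goodOrd_two_1727a1 not_hasRationalTwoTorsionX_1727a1 Δ_1727a1_neg' hr0 hμan (bsdp_two_1727a1_of_creutzMiller hCM hGZK hr0) hβ
    fun κP hκP => ⟨1, le_rfl, hrank κP hκP⟩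

end Summit.BirchSwinnertonDyer.BirchSwinnertonDyer.Theorems.AlignedTransportAtTwoCubicRankDoorLayerOne

end
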